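import Summits.QuantumFields.YangMills.Theorems.BalabanUVNodesN16CaptureOfUnique6
import HarnessLib

/-!
# Route «BalabanUVNodes» (K3⁷ `SpineGivenEndpointR13SepCoPH`, stmt-QuantumFields-20544), DAG node N16 = NE3 — THE JUNCTION'S INTERIOR LETTER, file 3:
# THE INTERIOR LEAF AND NODE N19's PIN ROWS FROM ANY LOOSE LEAF + CAPTURE, KEY-FREE

Cell `pub-ymgap`, width seat `pub-ymgap-dag-n16-w4`, generation 0, file 3 — over this seat's files 1∕2 (`BalabanUVNodesN16CaptureOfUnique6` p607700, `…Top` p608885) and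
dag-n16-w1's file 7 (`BalabanUVNodesN16InteriorOfCapture` p606074).  `--kind proof --supports stmt-QuantumFields-20544 --as helper` (count-neutral).  `bears_on: R4∕N16 · junction N16 → N19`.

THE POINT.  Node N19's (v′-16) value-letter clause is the INTERIOR leaf `LeafH3sup d L N ε ρ c D` (`ρ < ε`); file 7 proved «interior leaf ⟺ CAPTURE(ε → ρ)» and produced it,
and its two rows at K3⁷ v5's loose pin, from CAPTURE and the LOOSE leaf at radius `ρ` — but with the loose leaf keyed INSIDE the proofs to the displayed bundle
`(hGm, hG, hM, hT)` of [Balaban1985Variational] Thm 1 at leaf-06's torus instances, which dag-n16-w2 g4's `not_forall_thm1At_torusVP` (p608145) shows UNINHABITED (leaf-06's cube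
class, D-s3-3; repair (o1) = Thm 1 with (9)–(10) at big cubes, `hTbig`).  The step «loose leaf at `ρ` ∧ CAPTURE(ε → ρ) ⟹ interior leaf `(ε, ρ)`» is KEY-FREE nested-class logic
(a captured `ε`-minimiser is a `ρ`-minimiser, file 7's `isMinimiser_of_capture`).  THIS FILE types it ONCE over an ABSTRACT loose-leaf hypothesis `hloose : LeafH3sup d L N ρ ρ c D`
(§1), together with its (U6)⋆-keyed form (file 2 §1) and the two pin-level packagings (§2), so that ANY loose-leaf producer — n16-w1's `leafH3sup_loose_of_thm1At_torusVP` (old key),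
(o1)'s `leafH3sup_loose_of_thm1AtBig` (repaired key), or a future one — yields the interior leaf and node N19's conjunct at the pin by ONE application, and no re-key re-types the
capture step.

WHAT THIS FILE PROVES (kernel, theorems only, 0 `def`, 0 sorry; BY NAME).  §1 (generic `d`, `n`) ★ `leafH3sup_interior_of_loose_of_capture` (`LeafH3sup d L N ρ ρ c D → ρ ≤ ε →
CAPTURE(ε → ρ) on D → LeafH3sup d L N ε ρ c D`), `leafH3sup_interior_iff_capture_of_loose` (under the loose leaf and `ρ ≤ ε`: interior leaf ⟺ CAPTURE; ⟹ is file 7's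
`capture_of_leafH3sup`), ★ `leafH3sup_interior_of_loose_of_unique6_top` (loose leaf at `ρ` + existence of minimisers at `ρ` and at a top radius `ε⋆` + (U6)⋆ ∧ (ii)⋆ at `ε⋆`
through a free `Crit` ⟹ interior leaf at every `ρ ≤ ε ≤ ε⋆`; file 2 §1's argument, file 1 §2 + file 7 `capture_mono_outer`), `exists_sel_of_loose_of_capture` (file 7's two `sel` rows, KEY-FREE:
loose leaf + existence at the class radius + CAPTURE + the level-0 trivial leaf).  §2 (`d = 4`, the record's letters, `[NeZero N]`)
★ `leafH3sup_rateCarriers_of_pinnedLoose_of_loose_of_capture` (node N19's (v′-16) conjunct `LeafH3sup 4 R.ne3.L R.ne3.Nper R.ne3.ε R.ne3.b c' R.ne3.dom` at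
`R := rateCarriersOfRecord₁₃CoPH 𝔯 F θ hP g₀ os k`, every tuple and run length, under `N16PinnedLoose 𝔯 ℓ₃ B`, from a per-family loose leaf on the pinned loose data at radius
`ρ F ≤ (ℓ₃ F).ε`, CAPTURE((ℓ₃ F).ε → ρ F) there, the MATCH row `ρ F ≤ (ℓ₃ F).b` and `c F ≤ c'`; module 43's `rateCarriers_ne3_of_pinnedLoose` BY NAME),
`leafH3sup_rateCarriers_of_pinnedLoose_of_loose_of_unique6_top` (the same with CAPTURE from existence ×2 + (U6)⋆ ∧ (ii)⋆ per family at a top radius `εTop F ≥ (ℓ₃ F).ε`),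
`sel_rateCarriers_of_pinnedLoose_of_loose_of_capture` (file 7's pin-level `sel` rows, KEY-FREE).

HONEST FRAMING.  Pure bookkeeping (nested-class logic over landed theorems BY NAME); the loose leaf, the existence rows, (U6)⋆, (ii)⋆ and CAPTURE are DISPLAYED hypotheses,
asserted for NO family ([Balaban1985Variational] Thm 1 (8)–(10) and its sentence 2 are node N07's theorem; (ii)⋆ is the located closed-ball law of file 1's honesty row (i));
nothing of Bałaban asserted or refuted; no stub of K3⁷ v5 (`stub_rates13H` ∕ `stub_expansion13H`) closed; N16 ∕ N19 ∕ N07 NOT discharged; count-neutral (typed 28∕28 ·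
discharged 5∕27 · A 5∕28 unmoved); one finite four-torus at fixed `ε`, Bałaban AS PRINTED — NOT ℝ⁴, NOT infinite volume, NOT OS, NOT a mass gap; the YM mass gap (Clay) is NOT
proved by any of this — R4 closes the conditional finite-𝕋⁴ rung `BalabanLadder.UV` only; no summit statement is proved by this seat.
Context: [Balaban1985Variational] CMP **102** (1985) Thm 1 (8)–(10) p. 279.
-/

set_option autoImplicit false

open scoped BigOperators Matrix Matrix.Norms.L2Operator
open NormedSpace

namespace Summit.QuantumFields.YangMills.BalabanUVNodes.N16InteriorLeafOfLooseLeaf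

open Literature.MathematicalPhysics.QuantumFieldTheory.Balaban1983to89
open Literature.MathematicalPhysics.QuantumFieldTheory.Balaban1983to89.T4Continuum (T4Family ULoop)
open B7Prop1Explicit B7Prop2Explicit MatrixLog UnitaryModel
open T4AveragingDeficitWall hiding Site Plane Plaq Bond
open Summit.QuantumFields.BalabanUV.T4Continuum
open MinimalActionSandwich (IsMinimiser)
open MinimalActionRate (sfClass)
open MinimalActionRefine (RegularSup)
open MinimalActionDictionary (sfClass_mono isMinimiser_zero)
open LevelZeroRegular (regularSup_zero_of_sfClass_le)
open NE3.LeafIndexSockets (LeafH3sup)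
open NE3EnergyShapes (IsUnitarySite IsPeriodicSite)
open Node00 (Stage13HParams NE3Letters₁₁ ne3NperOfRecord₁₁ ne3DomOfRecord₁₁ MatA)
open YMDAG.UVSplit (RateReading₁₃CoPH rateCarriersOfRecord₁₃CoPH)
open Summit.QuantumFields.YangMills.BalabanUVNodes.N16H7OfReg9 (leafH3sup_mono)
open Summit.QuantumFields.YangMills.BalabanUVNodes.N16InteriorOfCapture (capture_of_leafH3sup isMinimiser_of_capture capture_mono_outer)
open Summit.QuantumFields.YangMills.BalabanUVNodes.N16PinnedLayer13CoPH (N16PinnedLoose rateCarriers_ne3_of_pinnedLoose)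
open Summit.QuantumFields.YangMills.BalabanUVNodes.N16CaptureOfUnique6 (capture_of_unique6_of_crit)

noncomputable section

section Generic

variable {d : ℕ} {n : Type} [Fintype n] [DecidableEq n]

/-! ## §1 The interior leaf from ANY loose leaf + CAPTURE -/

/-- **★ LOOSE LEAF AT RADIUS `ρ` ∧ CAPTURE(ε → ρ) ⟹ THE INTERIOR LEAF `(ε, ρ)`** on the same data `D`, for `ρ ≤ ε`: a minimiser over `sfClass ε` captured in `sfClass ρ` is a
minimiser over `sfClass ρ` (file 7's `isMinimiser_of_capture`), to which the loose leaf applies.  KEY-FREE: `hloose` is whatever produces the value-letter-equals-class-radius leaf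
([Balaban1985Variational] Thm 1 (8)–(10) at radius `ρ` in any typing), `hcap` whatever produces capture (file 1 ∕ file 2: sentence 2). [folklore] -/
theorem leafH3sup_interior_of_loose_of_capture {L N : ℕ} {ρ ε c : ℝ} {D : Set (Site d → Fin d → (Matrix n n ℂ)ˣ)}
    (hloose : LeafH3sup d L N ρ ρ c D) (hρε : ρ ≤ ε)
    (hcap : ∀ V ∈ D, ∀ (k : ℕ) (U : Site d → Fin d → (Matrix n n ℂ)ˣ), IsMinimiser d (sfClass d L N ε) L N (k + 1) V U → U ∈ sfClass d L N ρ (k + 1)) :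
    LeafH3sup d L N ε ρ c D :=
  fun V hV k U hU => hloose V hV k U (isMinimiser_of_capture hρε hU (hcap V hV k U hU))

/-- **UNDER THE LOOSE LEAF, THE INTERIOR LEAF IS EQUIVALENT TO CAPTURE** (`ρ ≤ ε`; ⟹ is file 7's `capture_of_leafH3sup`, which needs no loose leaf). [folklore] -/
theorem leafH3sup_interior_iff_capture_of_loose {L N : ℕ} {ρ ε c : ℝ} {D : Set (Site d → Fin d → (Matrix n n ℂ)ˣ)}
    (hloose : LeafH3sup d L N ρ ρ c D) (hρε : ρ ≤ ε) :
    LeafH3sup d L N ε ρ c D ↔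
      ∀ V ∈ D, ∀ (k : ℕ) (U : Site d → Fin d → (Matrix n n ℂ)ˣ), IsMinimiser d (sfClass d L N ε) L N (k + 1) V U → U ∈ sfClass d L N ρ (k + 1) :=
  ⟨capture_of_leafH3sup, leafH3sup_interior_of_loose_of_capture hloose hρε⟩

/-- **★ THE INTERIOR LEAF AT EVERY `ρ ≤ ε ≤ ε⋆` FROM THE LOOSE LEAF AT `ρ`, EXISTENCE AT `ρ` AND `ε⋆`, AND THE UNIQUENESS SENTENCE AT THE ONE RADIUS `ε⋆`** (file 2's
`capture_of_exists_of_unique6_top` feeding the previous lemma): `Crit` free; `h8` ∕ `hexTop` existence of minimisers over `sfClass ρ` ∕ `sfClass ε⋆` at every datum of `D`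
([Balaban1985Variational] Thm 1 (8) at the two radii); `hU6top` sentence 2 ∘ r2 `Laws` (iv) at `ε⋆`; `hcritTop` `Laws` (ii) at `ε⋆`. [cite: Balaban1985Variational, Thm 1 (8)–(10) p.279] -/
theorem leafH3sup_interior_of_loose_of_unique6_top [Nonempty n] {L N : ℕ} {ρ εTop c : ℝ} {D : Set (Site d → Fin d → (Matrix n n ℂ)ˣ)}
    (hloose : LeafH3sup d L N ρ ρ c D)
    (Crit : ℕ → (Site d → Fin d → (Matrix n n ℂ)ˣ) → (Site d → Fin d → (Matrix n n ℂ)ˣ) → Prop)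
    (h8 : ∀ V ∈ D, ∀ k : ℕ, ∃ U₀ : Site d → Fin d → (Matrix n n ℂ)ˣ, IsMinimiser d (sfClass d L N ρ) L N (k + 1) V U₀)
    (hexTop : ∀ V ∈ D, ∀ k : ℕ, ∃ U : Site d → Fin d → (Matrix n n ℂ)ˣ, IsMinimiser d (sfClass d L N εTop) L N (k + 1) V U)
    (hU6top : ∀ (k : ℕ), ∀ V ∈ D, ∀ U₀ : Site d → Fin d → (Matrix n n ℂ)ˣ, IsMinimiser d (sfClass d L N ρ) L N (k + 1) V U₀ →
      ∀ U : Site d → Fin d → (Matrix n n ℂ)ˣ, U ∈ sfClass d L N εTop (k + 1) → avgIter L U (k + 1) = V → Crit k V U →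
        ∃ u : Site d → (Matrix n n ℂ)ˣ, IsUnitarySite u ∧ IsPeriodicSite u ((N * L ^ (k + 1) : ℕ) : ℤ) ∧ gaugeAct u U₀ = U)
    (hcritTop : ∀ (k : ℕ) (V U : Site d → Fin d → (Matrix n n ℂ)ˣ), IsMinimiser d (sfClass d L N εTop) L N (k + 1) V U → Crit k V U)
    {ε : ℝ} (hρε : ρ ≤ ε) (hεT : ε ≤ εTop) :
    LeafH3sup d L N ε ρ c D := by
  -- CAPTURE at the top radius (file 1 §2 at each datum), carried down to `ε` by file 7's `capture_mono_outer` (= file 2 §1, inlined)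
  have hcapTop : ∀ V ∈ D, ∀ (k : ℕ) (U : Site d → Fin d → (Matrix n n ℂ)ˣ),
      IsMinimiser d (sfClass d L N εTop) L N (k + 1) V U → U ∈ sfClass d L N ρ (k + 1) := by
    intro V hV k U hU
    obtain ⟨U₀, hU₀⟩ := h8 V hV k
    exact capture_of_unique6_of_crit (Crit k) hU₀ (hU6top k V hV U₀ hU₀) (hcritTop k V) hU
  exact leafH3sup_interior_of_loose_of_capture hloose hρε (capture_mono_outer hρε hεT hcapTop hexTop)

/-- **THE TWO `sel` ROWS OF NODE N19's (v′-16) FROM ANY LOOSE LEAF + EXISTENCE + CAPTURE + THE LEVEL-0 TRIVIAL LEAF** (file 7's `exists_sel_of_thm1At_torusVP_of_capture`, KEY-FREE):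
displayed — the loose leaf at `ρ` on `D`, existence of a minimiser of every run `k+1` over `sfClass ε` at every datum of `D` ((8) at the class radius), CAPTURE(ε → ρ) on `D`; letters
`b ≥ ρ`, `c' ≥ c` and a datum radius `ε₁ ≤ min(ε, 1∕4, b, c'∕4)` with `D ⊆ sfClass ε₁ 0` (N19's own rows; run `0` = the datum, `isMinimiser_zero` + `LevelZeroRegular.regularSup_zero_of_sfClass_le`).
[cite: Balaban1985Variational, Thm 1 (8)–(10) p.279] -/
theorem exists_sel_of_loose_of_capture {L N : ℕ} {ρ ε c b c' ε₁ : ℝ} {D : Set (Site d → Fin d → (Matrix n n ℂ)ˣ)}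
    (hloose : LeafH3sup d L N ρ ρ c D) (hρε : ρ ≤ ε)
    (hex : ∀ V ∈ D, ∀ k : ℕ, ∃ U : Site d → Fin d → (Matrix n n ℂ)ˣ, IsMinimiser d (sfClass d L N ε) L N (k + 1) V U)
    (hcap : ∀ V ∈ D, ∀ (k : ℕ) (U : Site d → Fin d → (Matrix n n ℂ)ˣ), IsMinimiser d (sfClass d L N ε) L N (k + 1) V U → U ∈ sfClass d L N ρ (k + 1))
    (hρb : ρ ≤ b) (hcc : c ≤ c') (hε₁ε : ε₁ ≤ ε) (hε₁ : ε₁ ≤ 1 / 4) (hε₁b : ε₁ ≤ b) (hε₁c : 4 * ε₁ ≤ c') (hD₁ : D ⊆ sfClass d L N ε₁ 0) :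
    ∃ sel : ℕ → (Site d → Fin d → (Matrix n n ℂ)ˣ) → (Site d → Fin d → (Matrix n n ℂ)ˣ),
      (∀ V ∈ D, ∀ k : ℕ, IsMinimiser d (sfClass d L N ε) L N k V (sel k V)) ∧
      (∀ V ∈ D, ∀ k : ℕ, RegularSup d L N b c' k (sel k V)) := by
  classical
  have hex' : ∀ (k : ℕ) (V : Site d → Fin d → (Matrix n n ℂ)ˣ), ∃ U : Site d → Fin d → (Matrix n n ℂ)ˣ,
      V ∈ D → IsMinimiser d (sfClass d L N ε) L N (k + 1) V U := by
    intro k V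
    by_cases hV : V ∈ D
    · obtain ⟨U, hU⟩ := hex V hV k
      exact ⟨U, fun _ => hU⟩
    · exact ⟨V, fun h => absurd h hV⟩
  choose sel hsel using hex'
  have hleaf : LeafH3sup d L N ε ρ c D := leafH3sup_interior_of_loose_of_capture hloose hρε hcap
  refine ⟨fun k V => match k with | 0 => V | k + 1 => sel k V, fun V hV k => ?_, fun V hV k => ?_⟩
  · cases k with
    | zero => exact isMinimiser_zero (sfClass_mono hε₁ε (hD₁ hV))
    | succ k => exact hsel k V hV
  · cases k with
    | zero => exact regularSup_zero_of_sfClass_le hε₁ hε₁b hε₁c (hD₁ hV)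
    | succ k => exact (hleaf V hV k _ (hsel k V hV)).mono hρb hcc

end Generic

/-! ## §2 At K3⁷ v5's loose pin: node N19's (v′-16) conjunct from ANY per-family loose leaf + CAPTURE -/

section AtReading

variable {N : ℕ} [NeZero N]

/-- **★ NODE N19's (v′-16) CONJUNCT AT EVERY TUPLE AND RUN LENGTH, UNDER THE LOOSE PIN, FROM ANY PER-FAMILY LOOSE LEAF + CAPTURE.**  Displayed per family `F`: a radius
`ρ F ≤ (ℓ₃ F).ε` with a loose leaf `LeafH3sup 4 F.L Nper (ρ F) (ρ F) (c F) D_F` on the pinned loose data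
`D_F = {V ∈ ne3DomOfRecord₁₁ F N 0 0 | V ∈ sfClass 4 F.L Nper ((ℓ₃ F).ε ∕ B F) 0}` (any producer: (o1)'s big-cube Theorem 1, …), CAPTURE((ℓ₃ F).ε → ρ F) on `D_F`, the TIGHTENED
MATCH ROW `ρ F ≤ (ℓ₃ F).b` and the gradient row `c F ≤ c'`.  Conclusion as file 7 §4 (module 43's `rateCarriers_ne3_of_pinnedLoose` rewrites `R.ne3` to the loose object, whose
letters are `F.L`, `ne3NperOfRecord₁₁ F 0 0`, `(ℓ₃ F).ε`, `(ℓ₃ F).b` by `rfl`).  Not a discharge: every hypothesis stays displayed on N19's side. [cite: Balaban1985Variational, Thm 1 (8)–(10) p.279] -/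
theorem leafH3sup_rateCarriers_of_pinnedLoose_of_loose_of_capture {𝔯 : RateReading₁₃CoPH N} {ℓ₃ : T4Family → NE3Letters₁₁} {B : T4Family → ℝ}
    (hpin : N16PinnedLoose 𝔯 ℓ₃ B) {ρ c : T4Family → ℝ}
    (hloose : ∀ F : T4Family, LeafH3sup 4 F.L (ne3NperOfRecord₁₁ F 0 0) (ρ F) (ρ F) (c F)
      ({V | V ∈ ne3DomOfRecord₁₁ F N 0 0 ∧ V ∈ sfClass 4 F.L (ne3NperOfRecord₁₁ F 0 0) ((ℓ₃ F).ε / B F) 0} : Set (Site 4 → Fin 4 → (MatA N)ˣ)))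
    (hρε : ∀ F : T4Family, ρ F ≤ (ℓ₃ F).ε)
    (hcap : ∀ (F : T4Family), ∀ V ∈ ({V | V ∈ ne3DomOfRecord₁₁ F N 0 0 ∧ V ∈ sfClass 4 F.L (ne3NperOfRecord₁₁ F 0 0) ((ℓ₃ F).ε / B F) 0} :
        Set (Site 4 → Fin 4 → (MatA N)ˣ)), ∀ (k : ℕ) (U : Site 4 → Fin 4 → (MatA N)ˣ),
      IsMinimiser 4 (sfClass 4 F.L (ne3NperOfRecord₁₁ F 0 0) (ℓ₃ F).ε) F.L (ne3NperOfRecord₁₁ F 0 0) (k + 1) V U →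
        U ∈ sfClass 4 F.L (ne3NperOfRecord₁₁ F 0 0) (ρ F) (k + 1))
    (F : T4Family) (θ : Stage13HParams F N) (hP : θ.Provisos₁₃CoPH F N) (g₀ : ℕ → ℝ) (os : List (ULoop F)) (k : ℕ)
    {c' : ℝ} (hρb : ρ F ≤ (ℓ₃ F).b) (hc : c F ≤ c') :
    LeafH3sup 4 (rateCarriersOfRecord₁₃CoPH 𝔯 F θ hP g₀ os k).ne3.L (rateCarriersOfRecord₁₃CoPH 𝔯 F θ hP g₀ os k).ne3.Nper
      (rateCarriersOfRecord₁₃CoPH 𝔯 F θ hP g₀ os k).ne3.ε (rateCarriersOfRecord₁₃CoPH 𝔯 F θ hP g₀ os k).ne3.b c'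
      (rateCarriersOfRecord₁₃CoPH 𝔯 F θ hP g₀ os k).ne3.dom := by
  rw [rateCarriers_ne3_of_pinnedLoose hpin F θ hP g₀ os k]
  exact leafH3sup_mono (leafH3sup_interior_of_loose_of_capture (hloose F) (hρε F) (hcap F)) hρb hc

/-- **NODE N19's (v′-16) CONJUNCT AT THE LOOSE PIN FROM ANY PER-FAMILY LOOSE LEAF, EXISTENCE AT TWO RADII AND THE UNIQUENESS SENTENCE AT ONE TOP RADIUS** — the previous
theorem with CAPTURE supplied per family by file 2's `capture_of_exists_of_unique6_top`: displayed per family a top radius `εTop F ≥ (ℓ₃ F).ε`, existence of minimisers over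
`sfClass (ρ F)` and `sfClass (εTop F)` at the pinned loose data, (U6)⋆ through a free `Crit F` and `Laws` (ii) at `εTop F`. [cite: Balaban1985Variational, Thm 1 (8)–(10) p.279] -/
theorem leafH3sup_rateCarriers_of_pinnedLoose_of_loose_of_unique6_top {𝔯 : RateReading₁₃CoPH N} {ℓ₃ : T4Family → NE3Letters₁₁} {B : T4Family → ℝ}
    (hpin : N16PinnedLoose 𝔯 ℓ₃ B) {ρ c εTop : T4Family → ℝ}
    (hloose : ∀ F : T4Family, LeafH3sup 4 F.L (ne3NperOfRecord₁₁ F 0 0) (ρ F) (ρ F) (c F)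
      ({V | V ∈ ne3DomOfRecord₁₁ F N 0 0 ∧ V ∈ sfClass 4 F.L (ne3NperOfRecord₁₁ F 0 0) ((ℓ₃ F).ε / B F) 0} : Set (Site 4 → Fin 4 → (MatA N)ˣ)))
    (hρε : ∀ F : T4Family, ρ F ≤ (ℓ₃ F).ε) (hεT : ∀ F : T4Family, (ℓ₃ F).ε ≤ εTop F)
    (Crit : T4Family → ℕ → (Site 4 → Fin 4 → (MatA N)ˣ) → (Site 4 → Fin 4 → (MatA N)ˣ) → Prop)
    (h8 : ∀ (F : T4Family), ∀ V ∈ ({V | V ∈ ne3DomOfRecord₁₁ F N 0 0 ∧ V ∈ sfClass 4 F.L (ne3NperOfRecord₁₁ F 0 0) ((ℓ₃ F).ε / B F) 0} :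
        Set (Site 4 → Fin 4 → (MatA N)ˣ)), ∀ k : ℕ,
      ∃ U₀ : Site 4 → Fin 4 → (MatA N)ˣ, IsMinimiser 4 (sfClass 4 F.L (ne3NperOfRecord₁₁ F 0 0) (ρ F)) F.L (ne3NperOfRecord₁₁ F 0 0) (k + 1) V U₀)
    (hexTop : ∀ (F : T4Family), ∀ V ∈ ({V | V ∈ ne3DomOfRecord₁₁ F N 0 0 ∧ V ∈ sfClass 4 F.L (ne3NperOfRecord₁₁ F 0 0) ((ℓ₃ F).ε / B F) 0} :
        Set (Site 4 → Fin 4 → (MatA N)ˣ)), ∀ k : ℕ,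
      ∃ U : Site 4 → Fin 4 → (MatA N)ˣ, IsMinimiser 4 (sfClass 4 F.L (ne3NperOfRecord₁₁ F 0 0) (εTop F)) F.L (ne3NperOfRecord₁₁ F 0 0) (k + 1) V U)
    (hU6top : ∀ (F : T4Family) (k : ℕ), ∀ V ∈ ({V | V ∈ ne3DomOfRecord₁₁ F N 0 0 ∧ V ∈ sfClass 4 F.L (ne3NperOfRecord₁₁ F 0 0) ((ℓ₃ F).ε / B F) 0} :
        Set (Site 4 → Fin 4 → (MatA N)ˣ)),
      ∀ U₀ : Site 4 → Fin 4 → (MatA N)ˣ, IsMinimiser 4 (sfClass 4 F.L (ne3NperOfRecord₁₁ F 0 0) (ρ F)) F.L (ne3NperOfRecord₁₁ F 0 0) (k + 1) V U₀ →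
      ∀ U : Site 4 → Fin 4 → (MatA N)ˣ, U ∈ sfClass 4 F.L (ne3NperOfRecord₁₁ F 0 0) (εTop F) (k + 1) → avgIter F.L U (k + 1) = V → Crit F k V U →
        ∃ u : Site 4 → (MatA N)ˣ, IsUnitarySite u ∧ IsPeriodicSite u ((ne3NperOfRecord₁₁ F 0 0 * F.L ^ (k + 1) : ℕ) : ℤ) ∧ gaugeAct u U₀ = U)
    (hcritTop : ∀ (F : T4Family) (k : ℕ) (V U : Site 4 → Fin 4 → (MatA N)ˣ),
      IsMinimiser 4 (sfClass 4 F.L (ne3NperOfRecord₁₁ F 0 0) (εTop F)) F.L (ne3NperOfRecord₁₁ F 0 0) (k + 1) V U → Crit F k V U)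
    (F : T4Family) (θ : Stage13HParams F N) (hP : θ.Provisos₁₃CoPH F N) (g₀ : ℕ → ℝ) (os : List (ULoop F)) (k : ℕ)
    {c' : ℝ} (hρb : ρ F ≤ (ℓ₃ F).b) (hc : c F ≤ c') :
    LeafH3sup 4 (rateCarriersOfRecord₁₃CoPH 𝔯 F θ hP g₀ os k).ne3.L (rateCarriersOfRecord₁₃CoPH 𝔯 F θ hP g₀ os k).ne3.Nper
      (rateCarriersOfRecord₁₃CoPH 𝔯 F θ hP g₀ os k).ne3.ε (rateCarriersOfRecord₁₃CoPH 𝔯 F θ hP g₀ os k).ne3.b c'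
      (rateCarriersOfRecord₁₃CoPH 𝔯 F θ hP g₀ os k).ne3.dom :=
  leafH3sup_rateCarriers_of_pinnedLoose_of_loose_of_capture hpin hloose hρε
    (fun F' => capture_mono_outer (hρε F') (hεT F')
      (fun V hV k U hU => by
        obtain ⟨U₀, hU₀⟩ := h8 F' V hV k
        exact capture_of_unique6_of_crit (Crit F' k) hU₀ (hU6top F' k V hV U₀ hU₀) (hcritTop F' k V) hU)
      (hexTop F'))
    F θ hP g₀ os k hρb hc

/-- **NODE N19's (v′-16) `sel` ROWS AT EVERY TUPLE AND RUN LENGTH, UNDER THE LOOSE PIN, FROM ANY PER-FAMILY LOOSE LEAF + EXISTENCE + CAPTURE** (file 7's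
`sel_rateCarriers_of_pinnedLoose_of_capture`, KEY-FREE): displayed per family the loose leaf at `ρ F ≤ (ℓ₃ F).ε` on the pinned loose data, existence of minimisers of every run
`k+1` over `sfClass ((ℓ₃ F).ε)` there, CAPTURE((ℓ₃ F).ε → ρ F), the MATCH row `ρ F ≤ (ℓ₃ F).b`, `c F ≤ c'`, and N19's own datum-radius rows at `ε₁ := (ℓ₃ F).ε ∕ B F`
(`ε₁ ≤ (ℓ₃ F).ε`, `ε₁ ≤ 1∕4`, `ε₁ ≤ (ℓ₃ F).b`, `4ε₁ ≤ c'`). [cite: Balaban1985Variational, Thm 1 (8)–(10) p.279] -/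
theorem sel_rateCarriers_of_pinnedLoose_of_loose_of_capture {𝔯 : RateReading₁₃CoPH N} {ℓ₃ : T4Family → NE3Letters₁₁} {B : T4Family → ℝ}
    (hpin : N16PinnedLoose 𝔯 ℓ₃ B) {ρ c : T4Family → ℝ}
    (hloose : ∀ F : T4Family, LeafH3sup 4 F.L (ne3NperOfRecord₁₁ F 0 0) (ρ F) (ρ F) (c F)
      ({V | V ∈ ne3DomOfRecord₁₁ F N 0 0 ∧ V ∈ sfClass 4 F.L (ne3NperOfRecord₁₁ F 0 0) ((ℓ₃ F).ε / B F) 0} : Set (Site 4 → Fin 4 → (MatA N)ˣ)))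
    (hρε : ∀ F : T4Family, ρ F ≤ (ℓ₃ F).ε)
    (hex : ∀ (F : T4Family), ∀ V ∈ ({V | V ∈ ne3DomOfRecord₁₁ F N 0 0 ∧ V ∈ sfClass 4 F.L (ne3NperOfRecord₁₁ F 0 0) ((ℓ₃ F).ε / B F) 0} :
        Set (Site 4 → Fin 4 → (MatA N)ˣ)), ∀ k : ℕ,
      ∃ U : Site 4 → Fin 4 → (MatA N)ˣ, IsMinimiser 4 (sfClass 4 F.L (ne3NperOfRecord₁₁ F 0 0) (ℓ₃ F).ε) F.L (ne3NperOfRecord₁₁ F 0 0) (k + 1) V U)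
    (hcap : ∀ (F : T4Family), ∀ V ∈ ({V | V ∈ ne3DomOfRecord₁₁ F N 0 0 ∧ V ∈ sfClass 4 F.L (ne3NperOfRecord₁₁ F 0 0) ((ℓ₃ F).ε / B F) 0} :
        Set (Site 4 → Fin 4 → (MatA N)ˣ)), ∀ (k : ℕ) (U : Site 4 → Fin 4 → (MatA N)ˣ),
      IsMinimiser 4 (sfClass 4 F.L (ne3NperOfRecord₁₁ F 0 0) (ℓ₃ F).ε) F.L (ne3NperOfRecord₁₁ F 0 0) (k + 1) V U →
        U ∈ sfClass 4 F.L (ne3NperOfRecord₁₁ F 0 0) (ρ F) (k + 1))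
    (hε₁ : ∀ F : T4Family, (ℓ₃ F).ε / B F ≤ (ℓ₃ F).ε ∧ (ℓ₃ F).ε / B F ≤ 1 / 4 ∧ (ℓ₃ F).ε / B F ≤ (ℓ₃ F).b)
    (F : T4Family) (θ : Stage13HParams F N) (hP : θ.Provisos₁₃CoPH F N) (g₀ : ℕ → ℝ) (os : List (ULoop F)) (k : ℕ)
    {c' : ℝ} (hρb : ρ F ≤ (ℓ₃ F).b) (hc : c F ≤ c') (hε₁c : 4 * ((ℓ₃ F).ε / B F) ≤ c') :
    ∃ sel : ℕ → (Site 4 → Fin 4 → (MatA N)ˣ) → (Site 4 → Fin 4 → (MatA N)ˣ),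
      (∀ V ∈ (rateCarriersOfRecord₁₃CoPH 𝔯 F θ hP g₀ os k).ne3.dom, ∀ j : ℕ,
        IsMinimiser 4 (sfClass 4 (rateCarriersOfRecord₁₃CoPH 𝔯 F θ hP g₀ os k).ne3.L (rateCarriersOfRecord₁₃CoPH 𝔯 F θ hP g₀ os k).ne3.Nper
          (rateCarriersOfRecord₁₃CoPH 𝔯 F θ hP g₀ os k).ne3.ε) (rateCarriersOfRecord₁₃CoPH 𝔯 F θ hP g₀ os k).ne3.L
          (rateCarriersOfRecord₁₃CoPH 𝔯 F θ hP g₀ os k).ne3.Nper j V (sel j V)) ∧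
      (∀ V ∈ (rateCarriersOfRecord₁₃CoPH 𝔯 F θ hP g₀ os k).ne3.dom, ∀ j : ℕ,
        RegularSup 4 (rateCarriersOfRecord₁₃CoPH 𝔯 F θ hP g₀ os k).ne3.L (rateCarriersOfRecord₁₃CoPH 𝔯 F θ hP g₀ os k).ne3.Nper
          (rateCarriersOfRecord₁₃CoPH 𝔯 F θ hP g₀ os k).ne3.b c' j (sel j V)) := by
  obtain ⟨hε₁ε, hε₁4, hε₁b⟩ := hε₁ F
  rw [rateCarriers_ne3_of_pinnedLoose hpin F θ hP g₀ os k]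
  exact exists_sel_of_loose_of_capture (hloose F) (hρε F) (hex F) (hcap F) hρb hc hε₁ε hε₁4 hε₁b hε₁c (fun V hV => hV.2)

end AtReading

end

end Summit.QuantumFields.YangMills.BalabanUVNodes.N16InteriorLeafOfLooseLeaf
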